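import Summits.MatrixMultiplication.MatrixMultiplication.Theorems.CharacteristicContinuityEventualTransfer
import HarnessLib

/-!
# CharacteristicContinuityCorners — the two minimal exact corners of the characteristic axis, BY NAME
(decomp-mm cell, lens 5, generation 10)

By-name edges for `route-MatrixMultiplication-CharacteristicContinuity` after the items
`EventualTransfer` (K′, stmt-30790) and `ClusterAtTwo` (A, stmt-31172) were materialised in the route
file. Every statement here is a definitional re-reading of a theorem of
`Theorems/CharacteristicContinuityEventualTransfer.lean` (where K′ and A had to be written out), now
stated against the route's own declarations so that the edges are certified by type:

* `weakenings : (W → A) ∧ (K → K′)`, `necessity : S → A ∧ K′` (both new items are NECESSARY);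
* `S ↔ A ∧ K` (corner two, by name).  Corner one `S ↔ W ∧ K′`, the re-glued closing `W → K′ → S` and the
  abstract-profile schemas below `K′` are already landed BY NAME in
  `Theorems/CharacteristicContinuityResidualChain.lean` (generation 10) and are not restated here.

References: [cite: BurgisserClausenShokrollahi1997, Cor. (15.18)]; [cite: Blaser2013, Def. 5.1].
-/

set_option linter.dupNamespace false -- `MatrixMultiplication.MatrixMultiplication` (summit = problem, D-0017)

noncomputable section

open Literature.Computability.AlgebraicComplexity
open Summit.MatrixMultiplication.MatrixMultiplication.Theses.CharacteristicContinuity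
open Summit.MatrixMultiplication.MatrixMultiplication.Theorems.CharacteristicContinuityTransfer
open Summit.MatrixMultiplication.MatrixMultiplication.Theorems.CharacteristicContinuityEventualTransfer

namespace Summit.MatrixMultiplication.MatrixMultiplication.Theorems.CharacteristicContinuityCorners

/-- The two weakenings, by name: `W → A` (eventual fastness implies clustering at two) and
`K → K′` (continuity at zero implies eventual transfer; item 30790 is weaker than item 18039).
Stated as one conjunction so that no clause poses as a proof of an item. [folklore] -/
theorem weakenings :
    (LargeCharacteristicFast → ClusterAtTwo) ∧ (ContinuityAtZero → EventualTransfer) := by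
  refine ⟨fun hW ε hε p₀ => ?_, fun hK => eventualTransfer_of_continuityAtZero hK⟩
  obtain ⟨p₁, hp₁⟩ := hW ε hε
  obtain ⟨p, hpge, hprime⟩ := Nat.exists_infinite_primes (max p₀ p₁)
  exact ⟨p, ⟨hprime⟩, (le_max_left _ _).trans hpge, @hp₁ p ⟨hprime⟩ ((le_max_right _ _).trans hpge)⟩

-- The re-glued closing `W → K′ → S` and corner one `S ↔ W ∧ K′` by name are the landed
-- `CharacteristicContinuityResidualChain.matrixMultiplication_of_fast_of_eventualTransfer` /
-- `….matrixMultiplication_iff_fast_and_eventualTransfer'` (gate `dedup.landed`); the two abstract-profile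
-- schemas (`schema_eventual_imp_limTransfer`, `schema_limTransfer_not_eventual`) likewise live there.

/-- Corner two, by name: `S ↔ A ∧ K`. [folklore] -/
theorem matrixMultiplication_iff_clusterAtTwo_and_continuityAtZero :
    _root_.MatrixMultiplication ↔ ClusterAtTwo ∧ ContinuityAtZero :=
  matrixMultiplication_iff_cluster_and_continuity

/-- Both new items are NECESSARY: `S → A ∧ K′` (items 31172 and 30790). [folklore] -/
theorem necessity (hS : _root_.MatrixMultiplication) : ClusterAtTwo ∧ EventualTransfer :=
  ⟨(matrixMultiplication_iff_cluster_and_continuity.1 hS).1,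
    (matrixMultiplication_iff_fast_and_eventualTransfer.1 hS).2⟩

end Summit.MatrixMultiplication.MatrixMultiplication.Theorems.CharacteristicContinuityCorners

end
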